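/-
Copyright (c) 2026 the pub-hodgecm-mathlib formalisation cell (harness21).  Prover seat hodgecm-mathlib-F0P3-p01 (g31), «(D-RAM) FOUR-FRAME» road of crux H413, line LH4, MS ROAD A,
STAGE B ∕ B56₂ at ρ = 0: the ROOT-GLUED stratum `G₁(1, s)` (type 2) — stabiliser indices, the single torus orbit, the lattice count and `Σ w`.  2026-09-04.
-/
import Summits.HodgeConjecture.HodgeConjecture.Theorems.F0P3cDyRamDiagonalGluedStabiliserIndexFull   -- ★ p856033 (LH4-p08 (g2)): `mem_map_unitTorus_iff`, `relIndex_ratioLevel_unitTorus_eq`; brings ★ B5 (iii) FILES 1–2, ★ B1, ★ (O1)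
import Summits.HodgeConjecture.HodgeConjecture.Theorems.F0P3cDyRamDiagonalGluedTorusOrbits          -- ★ p855894 (LH4-p08 (g2)): `mapGL_diagGLUnits_latt_glued`, `exists_gl_coe_eq_glued`
import Summits.HodgeConjecture.HodgeConjecture.Theorems.F0P3cDyRamDiagonalStratumTools              -- ★ (LH4-p13 (g2)): `finsum_mem_eq_ncard_mul`
import HarnessLib

/-!
# Crux `H413`, MS ROAD A, STAGE B ∕ B56₂: the root-glued stratum `G₁(1, s)` (`ρ = 0`, type 2) — `W(y, ζ) = (1 0 0; 0 1 0; y ζ ϖ^c)`, `|ζ| = 1`, `|y| = |ϖ|^s`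

Cell `hodgecm-mathlib` (D-0151), FLOOR 0, crux item H413 = `stmt-HodgeConjecture-24833`; lane `--supports stmt-HodgeConjecture-24833 --as helper` (count-neutral).  THEOREMS ONLY
(no `def`, no instance, no notation, no `sorry`).  LH4-p10 (g2) MEMO v2.1 §T2.1∕§T2.3: the type-2 glued family `G₁(r, s)` at `r = 1` (`ρ = 0`) is `b = 0`, `c = 1 + s`, `x = 0`, `z = ζ` a unit,
`|y| = |ϖ|^s` — the frame `W(y, ζ)` of LH4-p09 (g2)'s `…TypeTwoZero` (type-2 polarisable UNCONDITIONALLY).  The `ρ ≥ 1` engine (★ p856076 ∕ p856198 ∕ p856228 ∕ p856265) does not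
cover it (it uses `ρ ≥ 1`); here everything is simpler — NO twisted homomorphism: for a unit vector `u`, `diag(u)·latt W = latt W ⟺ u₁∕u₂ ∈ U_c ∧ u₀∕u₂ ∈ U_{c−s}` (★ `mapGL_latt_hnf_eq_iff`
at `b = 0`, `x = 0`), two INDEPENDENT ratio conditions, so `[𝒰 : S_F] = [U_F : U_{F,c}]·[U_F : U_{F,c−s}]` and `[𝒯 : S̃] = [𝒪^× : U_c]·[𝒪^× : U_{c−s}]` (★ B1 (C4)∕(C3)); the whole family
`{latt W(y,ζ)}` is ONE `𝒯`-orbit (★ (iv-a) `mapGL_diagGLUnits_latt_glued` at `x = 0`, `p = 1`), hence has `[𝒯 : S̃]` members (★ (O1)); `T`-stability is all-or-nothing (`c ≤ n₁ ∧ c ≤ n₂ + s`).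
TYPE-2 LETTERS (`c = 1 + s`, `s ≥ 2` even): `[𝒰 : S_F] = ((q−1)q^{(s+2)∕2−1})·(q−1)`, `#lattices = ((q−1)q^s)·(q−1)`, and on the tube (`1 + s ≤ n₁`, `1 ≤ n₂`) **`Σ w = q^{s∕2}`** — the B10₂
skeleton 08e5e6e2 `G₁` tube value at ρ = 0 is `(q−1)·q^{s∕2}`: the coset multiplicity here is **`n₂ = q − 1`** (the polarisation condition `v(1 + wNζ) = s` EXACTLY is an annulus; flag
F0P3-p01 (g31) bus 2026-09-04T0x; invisible at q = 2).  All statements below are `n₂`-free.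
* §1 `mem_latticeStabilizer_latt_rhoZero_iff`; §2 `relIndex_fixedUnitStabilizer_latt_rhoZero_eq`, `relIndex_latticeStabilizer_latt_rhoZero_eq` (any `c` with `1 ≤ c − s`);
  §3 `ncard_rhoZero_eq` (the family is one orbit); §4 `finsum_stabiliserWeight_rhoZero_tube_typeTwo_eq` (`= q^{s∕2}`), `rhoZero_stable_eq_empty_of_lt` (`n₁ < 1 + s` ⇒ empty).
HONEST LABEL.  Count-neutral (`--supports`); the census laws (MS) stay PROVER TARGETS until the Stage B ∕ B9 assemblies land (type-2 heads under re-key, R-21); `HC_CM` is proved only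
modulo the 7 printed citations (2 remaining named inputs: hLiu418 = `stmt-HodgeConjecture-24832`, h413 = `stmt-HodgeConjecture-24833`) until rung 0 closes.

## References
* [Kottwitz1986BaseChangeUnits] R. E. Kottwitz, *Base change for unit elements of Hecke algebras*, Compositio Math. 60 (1986), §1 pp. 240–241 (fixed-lattice counting by torus orbits).
* [Serre1979] J.-P. Serre, *Local Fields*, GTM 67 (1979), Ch. IV §2 Prop. 6 (unit filtration indices).
* [Serre1980Trees] J.-P. Serre, *Trees*, Springer (1980), Ch. II §1.1 (lattices, Hermite normal form).
-/

set_option autoImplicit false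

noncomputable section

namespace Summit.HodgeConjecture.HodgeConjecture.Cruxes.H413.F0P3cDyRamDiagonalGluedRhoZero

open Matrix
open Literature.NumberTheory.Automorphic Literature.NumberTheory.Automorphic.HermitianLattice Literature.NumberTheory.Automorphic.UnitaryGroup
open Literature.NumberTheory.Automorphic.UnitaryLatticeTree
open Literature.NumberTheory.LocalFields.WildQuadraticDatum
open Summit.HodgeConjecture.HodgeConjecture.Cruxes.H413.F0P3cDyRamDiagonalTorusDefs
open Summit.HodgeConjecture.HodgeConjecture.Cruxes.H413.F0P3cDyRamDiagonalHNFStability (mapGL_latt_hnf_eq_iff)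
open Summit.HodgeConjecture.HodgeConjecture.Cruxes.H413.F0P3cDyRamDiagonalGluedFixedStabiliser (v_mul_inv_le_one_iff exists_unitLevel_subgroup mem_map_fixedUnitTorus_iff)
open Summit.HodgeConjecture.HodgeConjecture.Cruxes.H413.F0P3cDyRamDiagonalGluedStabiliserIndex (ne_zero_and_v_lt_one_of_v_eq_exp v_div_sub_one_eq relIndex_ratioLevel_fixedUnitTorus_eq)
open Summit.HodgeConjecture.HodgeConjecture.Cruxes.H413.F0P3cDyRamDiagonalGluedStabiliserIndexFull (mem_map_unitTorus_iff relIndex_ratioLevel_unitTorus_eq)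
open Summit.HodgeConjecture.HodgeConjecture.Cruxes.H413.F0P3cDyRamDiagonalGluedTorusOrbits (mapGL_diagGLUnits_latt_glued exists_gl_coe_eq_glued)
open Summit.HodgeConjecture.HodgeConjecture.Cruxes.H413.F0P3cDyRamDiagonalUnitTorusOrbit (ncard_unitTorus_orbit_eq_relIndex)
open Summit.HodgeConjecture.HodgeConjecture.Cruxes.H413.F0P3cDyRamDiagonalStratumTools (finsum_mem_eq_ncard_mul)
open scoped Valued WithZero Matrix MatrixGroups

variable {K : Type*} [Field K] [Valued K ℤᵐ⁰]

/-! ## §1  Membership in the diagonal stabiliser of the root-glued frame -/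

/-- **`diag(u)·latt W = latt W ⟺ |u₂ − u₁| ≤ |ϖ|^c ∧ |u₂ − u₀| ≤ |ϖ|^{c−s}`** for units `u` and `W = (1 0 0; 0 1 0; y ζ ϖ^c)`, `|ζ| = 1`, `|y| = |ϖ|^s`, `s ≤ c` (★ `mapGL_latt_hnf_eq_iff` at `b = 0`,
`x = 0`: the first congruence is void, the other two are `|(u₂−u₁)ζ| ≤ |ϖ|^c` and `|(u₂−u₀)y| ≤ |ϖ|^c`). [cite: Serre1980Trees, Ch. II §1.1] [cite: Kottwitz1986BaseChangeUnits, §1 pp. 240–241] -/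
theorem mem_latticeStabilizer_latt_rhoZero_iff {ϖ : K} (hϖ0 : ϖ ≠ 0) {s c : ℕ} (hsc : s ≤ c) {y ζ : K} (hζ : Valued.v ζ = 1) (hy : Valued.v y = Valued.v ϖ ^ s)
    (V : GL (Fin 3) K) (hV : (V : Matrix (Fin 3) (Fin 3) K) = !![1, 0, 0; 0, 1, 0; y, ζ, ϖ ^ c]) (u : Fin 3 → Kˣ) (hu : ∀ i, Valued.v (u i : K) = 1) :
    u ∈ latticeStabilizer (latt (V : Matrix (Fin 3) (Fin 3) K)) ↔
      Valued.v ((u 2 : K) - u 1) ≤ Valued.v ϖ ^ c ∧ Valued.v ((u 2 : K) - u 0) ≤ Valued.v ϖ ^ (c - s) := by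
  have hvϖ : 0 < Valued.v ϖ := (Valuation.pos_iff _).2 hϖ0
  have hc0 : (ϖ ^ c : K) ≠ 0 := pow_ne_zero _ hϖ0
  have hV' : (V : Matrix (Fin 3) (Fin 3) K) = !![1, 0, 0; 0, ϖ ^ 0, 0; y, ζ, ϖ ^ c] := by rw [hV, pow_zero]
  rw [mem_latticeStabilizer_iff, mapGL_latt_hnf_eq_iff hϖ0 (fun i => (u i : K)) hu (diagGLUnits u) (coe_diagGLUnits u) V hV']
  have h1 : Valued.v (((u 1 : K) - u 0) * 0 * (ϖ ^ 0)⁻¹) ≤ 1 := by rw [mul_zero, zero_mul, map_zero]; exact zero_le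
  simp only [h1, true_and]
  refine and_congr ?_ ?_
  · rw [v_mul_inv_le_one_iff hc0, map_mul, hζ, mul_one, map_pow]
  · rw [show ((u 2 : K) - u 0) * y + ((u 0 : K) - u 1) * 0 * ζ * (ϖ ^ 0)⁻¹ = ((u 2 : K) - u 0) * y by ring, v_mul_inv_le_one_iff hc0, map_mul, hy, map_pow,
      ← Nat.sub_add_cancel hsc, pow_add, Nat.add_sub_cancel]
    exact mul_le_mul_iff_left₀ (pow_pos hvϖ _)

/-! ## §2  The two stabiliser indices: two independent ratio conditions -/

/-- **`u ↦ u₀∕u₂` MAPS `{u ∈ 𝒰 | u₁∕u₂ ∈ U_n}` ONTO THE FIXED UNITS** (onto: `u = (w, 1, 1)`). [cite: Kottwitz1986BaseChangeUnits, §1 pp. 240–241] -/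
theorem mem_map_ratioLevel_fixedUnitTorus_iff (σ : K →+* K) {ϖ : K} {n : ℕ} (π₁ π₂ : (Fin 3 → Kˣ) →* Kˣ) (hπ₁ : ∀ u, π₁ u = u 1 / u 2) (hπ₂ : ∀ u, π₂ u = u 0 / u 2)
    (Un : Subgroup Kˣ) (hUn : ∀ w : Kˣ, w ∈ Un ↔ Valued.v (w : K) = 1 ∧ Valued.v ((w : K) - 1) ≤ Valued.v ϖ ^ n) (w : Kˣ) :
    w ∈ (Un.comap π₁ ⊓ fixedUnitTorus σ 3).map π₂ ↔ σ w = w ∧ Valued.v (w : K) = 1 := by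
  rw [Subgroup.mem_map]
  constructor
  · rintro ⟨u, hu, rfl⟩
    obtain ⟨hu1, hu2⟩ := (mem_fixedUnitTorus_iff σ u).1 (Subgroup.mem_inf.1 hu).2
    rw [hπ₂, Units.val_div_eq_div_val]
    exact ⟨by rw [map_div₀, hu2, hu2], by rw [map_div₀, hu1, hu1, div_one]⟩
  · rintro ⟨hσw, hvw⟩
    have h10 : (1 : Fin 3) ≠ 0 := by decide
    have h20 : (2 : Fin 3) ≠ 0 := by decide
    refine ⟨Pi.mulSingle 0 w, Subgroup.mem_inf.2 ⟨?_, (mem_fixedUnitTorus_iff σ _).2 ⟨fun i => ?_, fun i => ?_⟩⟩, ?_⟩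
    · rw [Subgroup.mem_comap, hUn, hπ₁, Pi.mulSingle_eq_of_ne h10, Pi.mulSingle_eq_of_ne h20, div_one, Units.val_one, sub_self, map_one, map_zero]
      exact ⟨rfl, zero_le⟩
    · by_cases hi : i = 0
      · subst hi; rw [Pi.mulSingle_eq_same]; exact hvw
      · rw [Pi.mulSingle_eq_of_ne hi, Units.val_one, map_one]
    · by_cases hi : i = 0
      · subst hi; rw [Pi.mulSingle_eq_same]; exact hσw
      · rw [Pi.mulSingle_eq_of_ne hi, Units.val_one, map_one]
    · rw [hπ₂, Pi.mulSingle_eq_same, Pi.mulSingle_eq_of_ne h20, div_one]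

/-- The same for the FULL unit torus: `u ↦ u₀∕u₂` maps `{u ∈ 𝒯 | u₁∕u₂ ∈ U_n}` onto `𝒪^×`. [cite: Kottwitz1986BaseChangeUnits, §1 pp. 240–241] -/
theorem mem_map_ratioLevel_unitTorus_iff {ϖ : K} {n : ℕ} (π₁ π₂ : (Fin 3 → Kˣ) →* Kˣ) (hπ₁ : ∀ u, π₁ u = u 1 / u 2) (hπ₂ : ∀ u, π₂ u = u 0 / u 2)
    (Un : Subgroup Kˣ) (hUn : ∀ w : Kˣ, w ∈ Un ↔ Valued.v (w : K) = 1 ∧ Valued.v ((w : K) - 1) ≤ Valued.v ϖ ^ n) (w : Kˣ) :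
    w ∈ (Un.comap π₁ ⊓ unitTorus K 3).map π₂ ↔ Valued.v (w : K) = 1 := by
  rw [Subgroup.mem_map]
  constructor
  · rintro ⟨u, hu, rfl⟩
    have hu1 := (mem_unitTorus_iff u).1 (Subgroup.mem_inf.1 hu).2
    rw [hπ₂, Units.val_div_eq_div_val, map_div₀, hu1, hu1, div_one]
  · intro hvw
    have h10 : (1 : Fin 3) ≠ 0 := by decide
    have h20 : (2 : Fin 3) ≠ 0 := by decide
    refine ⟨Pi.mulSingle 0 w, Subgroup.mem_inf.2 ⟨?_, (mem_unitTorus_iff _).2 fun i => ?_⟩, ?_⟩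
    · rw [Subgroup.mem_comap, hUn, hπ₁, Pi.mulSingle_eq_of_ne h10, Pi.mulSingle_eq_of_ne h20, div_one, Units.val_one, sub_self, map_one, map_zero]
      exact ⟨rfl, zero_le⟩
    · by_cases hi : i = 0
      · subst hi; rw [Pi.mulSingle_eq_same]; exact hvw
      · rw [Pi.mulSingle_eq_of_ne hi, Units.val_one, map_one]
    · rw [hπ₂, Pi.mulSingle_eq_same, Pi.mulSingle_eq_of_ne h20, div_one]

/-- **THE FIXED STABILISER INDEX OF A ROOT-GLUED LATTICE**: `[𝒰 : S_F(latt W)] = ((q−1)q^{(c+1)∕2−1}) · ((q−1)q^{(c−s+1)∕2−1})` (`|ζ| = 1`, `|y| = |ϖ|^s`, `1 ≤ c − s`): the conditions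
`u₁∕u₂ ∈ U_{F,c}`, `u₀∕u₂ ∈ U_{F,c−s}` are independent (★ B1 (C4) twice along `u ↦ u₁∕u₂`, `u ↦ u₀∕u₂`). [cite: Kottwitz1986BaseChangeUnits, §1 pp. 240–241] [cite: Serre1979, Ch. IV §2 Prop. 6] -/
theorem relIndex_fixedUnitStabilizer_latt_rhoZero_eq {σ : K →+* K} (hσ : ∀ a, σ (σ a) = a) (hvσ : ∀ a, Valued.v (σ a) = Valued.v a)
    (hfix : ∀ x : K, σ x = x → x ≠ 0 → ∃ n : ℤ, Valued.v x = WithZero.exp (2 * n)) {ϖ : K} (hϖ : Valued.v ϖ = WithZero.exp (-1 : ℤ))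
    {d : ℕ} (hd : Valued.v (ϖ - σ ϖ) = Valued.v ϖ ^ d) [Finite 𝓀[K]] {s c : ℕ} (hsc : s + 1 ≤ c) {y ζ : K} (hζ : Valued.v ζ = 1) (hy : Valued.v y = Valued.v ϖ ^ s)
    (V : GL (Fin 3) K) (hV : (V : Matrix (Fin 3) (Fin 3) K) = !![1, 0, 0; 0, 1, 0; y, ζ, ϖ ^ c]) :
    (fixedUnitStabilizer σ (latt (V : Matrix (Fin 3) (Fin 3) K))).relIndex (fixedUnitTorus σ 3) =
      ((Nat.card 𝓀[K] - 1) * Nat.card 𝓀[K] ^ ((c + 1) / 2 - 1)) * ((Nat.card 𝓀[K] - 1) * Nat.card 𝓀[K] ^ ((c - s + 1) / 2 - 1)) := by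
  obtain ⟨hϖ0, -⟩ := ne_zero_and_v_lt_one_of_v_eq_exp hϖ
  obtain ⟨Uc, hUc⟩ := exists_unitLevel_subgroup (K := K) (Valued.v ϖ ^ c)
  obtain ⟨Ud, hUd⟩ := exists_unitLevel_subgroup (K := K) (Valued.v ϖ ^ (c - s))
  let π₁ : (Fin 3 → Kˣ) →* Kˣ := Pi.evalMonoidHom (fun _ : Fin 3 => Kˣ) 1 / Pi.evalMonoidHom (fun _ : Fin 3 => Kˣ) 2
  let π₂ : (Fin 3 → Kˣ) →* Kˣ := Pi.evalMonoidHom (fun _ : Fin 3 => Kˣ) 0 / Pi.evalMonoidHom (fun _ : Fin 3 => Kˣ) 2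
  have hπ₁ : ∀ u, π₁ u = u 1 / u 2 := fun u => rfl
  have hπ₂ : ∀ u, π₂ u = u 0 / u 2 := fun u => rfl
  set T := fixedUnitTorus σ 3 with hT
  set S₁ := Uc.comap π₁ ⊓ T with hS₁
  -- the stabiliser as a double comap
  have hS : fixedUnitStabilizer σ (latt (V : Matrix (Fin 3) (Fin 3) K)) = Ud.comap π₂ ⊓ S₁ := by
    ext u
    rw [hS₁, Subgroup.mem_inf, Subgroup.mem_inf, Subgroup.mem_comap, Subgroup.mem_comap, hUc, hUd, hπ₁, hπ₂, Units.val_div_eq_div_val,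
      Units.val_div_eq_div_val, hT, mem_fixedUnitStabilizer_iff, ← mem_latticeStabilizer_iff, mem_fixedUnitTorus_iff]
    constructor
    · rintro ⟨hstab, hu1, hu2⟩
      obtain ⟨hb, ha⟩ := (mem_latticeStabilizer_latt_rhoZero_iff hϖ0 (by omega) hζ hy V hV u hu1).1 hstab
      refine ⟨⟨by rw [map_div₀, hu1 0, hu1 2, div_one], by rw [v_div_sub_one_eq (hu1 2)]; exact ha⟩,
        ⟨by rw [map_div₀, hu1 1, hu1 2, div_one], by rw [v_div_sub_one_eq (hu1 2)]; exact hb⟩, hu1, hu2⟩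
    · rintro ⟨⟨-, ha⟩, ⟨-, hb⟩, hu1, hu2⟩
      rw [v_div_sub_one_eq (hu1 2)] at ha hb
      exact ⟨(mem_latticeStabilizer_latt_rhoZero_iff hϖ0 (by omega) hζ hy V hV u hu1).2 ⟨hb, ha⟩, hu1, hu2⟩
  have hle : Ud.comap π₂ ⊓ S₁ ≤ S₁ := inf_le_right
  rw [hS, ← Subgroup.relIndex_mul_relIndex _ _ _ hle (inf_le_right : S₁ ≤ T), Subgroup.inf_relIndex_right, Subgroup.relIndex_comap,
    ← Subgroup.inf_relIndex_right, hS₁, relIndex_ratioLevel_fixedUnitTorus_eq hσ hvσ hfix hϖ hd (n := c) (by omega) π₁ hπ₁ Uc hUc, Nat.mul_comm]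
  congr 1
  refine relIndex_fixedUnitLevel_eq hσ hvσ hfix hϖ hd (U := (Uc.comap π₁ ⊓ fixedUnitTorus σ 3).map π₂) (Un := Ud ⊓ (Uc.comap π₁ ⊓ fixedUnitTorus σ 3).map π₂)
    (fun w => mem_map_ratioLevel_fixedUnitTorus_iff σ π₁ π₂ hπ₁ hπ₂ Uc hUc w) (n := c - s) (by omega) (fun w => ?_)
  rw [Subgroup.mem_inf, hUd, mem_map_ratioLevel_fixedUnitTorus_iff σ π₁ π₂ hπ₁ hπ₂ Uc hUc, v_pow_eq_exp_neg hϖ]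
  tauto

/-- **THE FULL-TORUS STABILISER INDEX OF A ROOT-GLUED LATTICE**: `[𝒯 : S̃(latt W)] = ((q−1)q^{c−1}) · ((q−1)q^{c−s−1})` (`1 ≤ c − s`; ★ B1 (C3) twice).
[cite: Kottwitz1986BaseChangeUnits, §1 pp. 240–241] [cite: Serre1979, Ch. IV §2 Prop. 6] -/
theorem relIndex_latticeStabilizer_latt_rhoZero_eq {ϖ : K} (hϖ : Valued.v ϖ = WithZero.exp (-1 : ℤ)) [Finite 𝓀[K]] {s c : ℕ} (hsc : s + 1 ≤ c)
    {y ζ : K} (hζ : Valued.v ζ = 1) (hy : Valued.v y = Valued.v ϖ ^ s)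
    (V : GL (Fin 3) K) (hV : (V : Matrix (Fin 3) (Fin 3) K) = !![1, 0, 0; 0, 1, 0; y, ζ, ϖ ^ c]) :
    (latticeStabilizer (latt (V : Matrix (Fin 3) (Fin 3) K))).relIndex (unitTorus K 3) =
      ((Nat.card 𝓀[K] - 1) * Nat.card 𝓀[K] ^ (c - 1)) * ((Nat.card 𝓀[K] - 1) * Nat.card 𝓀[K] ^ (c - s - 1)) := by
  obtain ⟨hϖ0, -⟩ := ne_zero_and_v_lt_one_of_v_eq_exp hϖ
  obtain ⟨Uc, hUc⟩ := exists_unitLevel_subgroup (K := K) (Valued.v ϖ ^ c)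
  obtain ⟨Ud, hUd⟩ := exists_unitLevel_subgroup (K := K) (Valued.v ϖ ^ (c - s))
  let π₁ : (Fin 3 → Kˣ) →* Kˣ := Pi.evalMonoidHom (fun _ : Fin 3 => Kˣ) 1 / Pi.evalMonoidHom (fun _ : Fin 3 => Kˣ) 2
  let π₂ : (Fin 3 → Kˣ) →* Kˣ := Pi.evalMonoidHom (fun _ : Fin 3 => Kˣ) 0 / Pi.evalMonoidHom (fun _ : Fin 3 => Kˣ) 2
  have hπ₁ : ∀ u, π₁ u = u 1 / u 2 := fun u => rfl
  have hπ₂ : ∀ u, π₂ u = u 0 / u 2 := fun u => rfl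
  set T := unitTorus K 3 with hT
  set S₁ := Uc.comap π₁ ⊓ T with hS₁
  have hS : latticeStabilizer (latt (V : Matrix (Fin 3) (Fin 3) K)) ⊓ T = Ud.comap π₂ ⊓ S₁ := by
    ext u
    rw [hS₁, Subgroup.mem_inf, Subgroup.mem_inf, Subgroup.mem_inf, Subgroup.mem_comap, Subgroup.mem_comap, hUc, hUd, hπ₁, hπ₂, Units.val_div_eq_div_val,
      Units.val_div_eq_div_val, hT, mem_unitTorus_iff]
    constructor
    · rintro ⟨hstab, hu1⟩
      obtain ⟨hb, ha⟩ := (mem_latticeStabilizer_latt_rhoZero_iff hϖ0 (by omega) hζ hy V hV u hu1).1 hstab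
      exact ⟨⟨by rw [map_div₀, hu1 0, hu1 2, div_one], by rw [v_div_sub_one_eq (hu1 2)]; exact ha⟩,
        ⟨by rw [map_div₀, hu1 1, hu1 2, div_one], by rw [v_div_sub_one_eq (hu1 2)]; exact hb⟩, hu1⟩
    · rintro ⟨⟨-, ha⟩, ⟨-, hb⟩, hu1⟩
      rw [v_div_sub_one_eq (hu1 2)] at ha hb
      exact ⟨(mem_latticeStabilizer_latt_rhoZero_iff hϖ0 (by omega) hζ hy V hV u hu1).2 ⟨hb, ha⟩, hu1⟩
  have hle : Ud.comap π₂ ⊓ S₁ ≤ S₁ := inf_le_right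
  rw [← Subgroup.inf_relIndex_right (latticeStabilizer _) T, hS, ← Subgroup.relIndex_mul_relIndex _ _ _ hle (inf_le_right : S₁ ≤ T), Subgroup.inf_relIndex_right,
    Subgroup.relIndex_comap, ← Subgroup.inf_relIndex_right, hS₁, relIndex_ratioLevel_unitTorus_eq hϖ (n := c) (by omega) π₁ hπ₁ Uc hUc, Nat.mul_comm]
  congr 1
  refine relIndex_unitLevel_eq hϖ (U := (Uc.comap π₁ ⊓ unitTorus K 3).map π₂) (Un := Ud ⊓ (Uc.comap π₁ ⊓ unitTorus K 3).map π₂)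
    (fun w => mem_map_ratioLevel_unitTorus_iff π₁ π₂ hπ₁ hπ₂ Uc hUc w) (n := c - s) (by omega) (fun w => ?_)
  rw [Subgroup.mem_inf, hUd, mem_map_ratioLevel_unitTorus_iff π₁ π₂ hπ₁ hπ₂ Uc hUc, v_pow_eq_exp_neg hϖ]
  tauto

/-! ## §3  The family `{latt W(y, ζ)}` is a single torus orbit; its size -/

/-- **`diag(u)·latt W(y, ζ) = latt W(y·u₂∕u₀, ζ·u₂∕u₁)`** (★ (iv-a) `mapGL_diagGLUnits_latt_glued` at `x = 0`, `p = 1`). [cite: Kottwitz1986BaseChangeUnits, §1 pp. 240–241] -/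
theorem mapGL_diagGLUnits_latt_rhoZero (u : Fin 3 → Kˣ) (hu : u ∈ unitTorus K 3) (y ζ r : K) (V : GL (Fin 3) K)
    (hV : (V : Matrix (Fin 3) (Fin 3) K) = !![1, 0, 0; 0, 1, 0; y, ζ, r]) :
    mapGL (diagGLUnits u) (latt (V : Matrix (Fin 3) (Fin 3) K)) = latt (!![1, 0, 0; 0, 1, 0; y * ((u 2 : K) / u 0), ζ * ((u 2 : K) / u 1), r] : Matrix (Fin 3) (Fin 3) K) := by
  have hV' : (V : Matrix (Fin 3) (Fin 3) K) = !![1, 0, 0; 0, 1, 0; 0 * ζ + y, 1 * ζ, r] := by rw [hV, zero_mul, zero_add, one_mul]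
  rw [mapGL_diagGLUnits_latt_glued u hu 0 ζ y 1 r V hV', zero_mul, zero_mul, zero_add, one_mul]

/-- **THE ROOT-GLUED FAMILY IS ONE ORBIT AND HAS `((q−1)q^{c−1})·((q−1)q^{c−s−1})` MEMBERS** (`1 ≤ c − s`): every `latt W(y, ζ)` with `|ζ| = 1`, `|y| = |ϖ|^s` is `diag(1, ζ⁻¹·?, …)`… precisely
`diag(1, y(ϖ^s ζ)⁻¹, y ϖ^{−s})·latt W(ϖ^s, 1)`, and conversely; then ★ (O1) + §2. [cite: Kottwitz1986BaseChangeUnits, §1 pp. 240–241] -/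
theorem ncard_rhoZero_eq {ϖ : K} (hϖ : Valued.v ϖ = WithZero.exp (-1 : ℤ)) [Finite 𝓀[K]] {s c : ℕ} (hsc : s + 1 ≤ c) :
    {M : Submodule 𝒪[K] (Fin 3 → K) | ∃ y ζ : K, Valued.v ζ = 1 ∧ Valued.v y = Valued.v ϖ ^ s ∧
        M = latt (!![1, 0, 0; 0, 1, 0; y, ζ, ϖ ^ c] : Matrix (Fin 3) (Fin 3) K)}.ncard =
      ((Nat.card 𝓀[K] - 1) * Nat.card 𝓀[K] ^ (c - 1)) * ((Nat.card 𝓀[K] - 1) * Nat.card 𝓀[K] ^ (c - s - 1)) := by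
  obtain ⟨hϖ0, -⟩ := ne_zero_and_v_lt_one_of_v_eq_exp hϖ
  have hps : (ϖ ^ s : K) ≠ 0 := pow_ne_zero _ hϖ0
  -- the reference lattice `W(ϖ^s, 1)`
  obtain ⟨V₀, hV₀'⟩ := exists_gl_coe_eq_glued (0 : K) 1 (ϖ ^ s) (one_ne_zero) (pow_ne_zero c hϖ0)
  have hV₀ : (V₀ : Matrix (Fin 3) (Fin 3) K) = !![1, 0, 0; 0, 1, 0; ϖ ^ s, 1, ϖ ^ c] := by rw [hV₀', zero_mul, zero_add, one_mul]
  have hset : {M : Submodule 𝒪[K] (Fin 3 → K) | ∃ y ζ : K, Valued.v ζ = 1 ∧ Valued.v y = Valued.v ϖ ^ s ∧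
        M = latt (!![1, 0, 0; 0, 1, 0; y, ζ, ϖ ^ c] : Matrix (Fin 3) (Fin 3) K)} =
      {M | ∃ u ∈ unitTorus K 3, M = mapGL (diagGLUnits u) (latt (V₀ : Matrix (Fin 3) (Fin 3) K))} := by
    ext M
    simp only [Set.mem_setOf_eq]
    constructor
    · rintro ⟨y, ζ, hζ, hy, rfl⟩
      have hy0 : y ≠ 0 := fun h => by rw [h, map_zero] at hy; exact pow_ne_zero _ ((Valuation.ne_zero_iff _).2 hϖ0) hy.symm
      have hζ0 : ζ ≠ 0 := fun h => by rw [h, map_zero] at hζ; exact zero_ne_one hζ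
      -- `u = (1, y∕(ϖ^s ζ), y∕ϖ^s)`
      have hvq : Valued.v (y * (ϖ ^ s)⁻¹) = 1 := by rw [map_mul, map_inv₀, hy, map_pow, mul_inv_cancel₀ (pow_ne_zero _ ((Valuation.ne_zero_iff _).2 hϖ0))]
      have hvq' : Valued.v (y * (ϖ ^ s)⁻¹ * ζ⁻¹) = 1 := by rw [map_mul, hvq, map_inv₀, hζ, inv_one, one_mul]
      let u : Fin 3 → Kˣ := ![1, Units.mk0 _ (by rw [← (Valuation.ne_zero_iff Valued.v)]; rw [hvq']; exact one_ne_zero),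
        Units.mk0 _ (by rw [← (Valuation.ne_zero_iff Valued.v)]; rw [hvq]; exact one_ne_zero)]
      have hu : u ∈ unitTorus K 3 := by
        rw [mem_unitTorus_iff]; intro i; fin_cases i
        · simp [u]
        · simpa [u] using hvq'
        · simpa [u] using hvq
      refine ⟨u, hu, ?_⟩
      rw [mapGL_diagGLUnits_latt_rhoZero u hu (ϖ ^ s) 1 (ϖ ^ c) V₀ hV₀]
      congr 1
      ext i j
      fin_cases i <;> fin_cases j <;> simp [u] <;> field_simp
    · rintro ⟨u, hu, rfl⟩
      have hu1 := (mem_unitTorus_iff u).1 hu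
      refine ⟨ϖ ^ s * ((u 2 : K) / u 0), 1 * ((u 2 : K) / u 1), by rw [one_mul, map_div₀, hu1, hu1, div_one],
        by rw [map_mul, map_div₀, hu1, hu1, div_one, mul_one, map_pow], ?_⟩
      rw [mapGL_diagGLUnits_latt_rhoZero u hu (ϖ ^ s) 1 (ϖ ^ c) V₀ hV₀]
  rw [hset, ncard_unitTorus_orbit_eq_relIndex,
    relIndex_latticeStabilizer_latt_rhoZero_eq hϖ hsc (y := ϖ ^ s) (ζ := 1) (map_one _) (map_pow _ _ _) V₀ hV₀]

/-! ## §4  `Σ w` on the tube and the empty regime (type-2 letters `c = 1 + s`) -/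

/-- **EVERY ROOT-GLUED LATTICE IS `T`-STABLE ON THE TUBE** (`T = diag(α, β, 1)`, `|β−1| = |ϖ|^{n₁}`, `|α−1| = |ϖ|^{n₂}`, `1 + s ≤ n₁`, `1 ≤ n₂`): the congruences of ★ `mapGL_latt_hnf_eq_iff` at
`b = 0`, `x = 0` read `|(β−1)ζ| ≤ |ϖ|^{1+s}`, `|(α−1)y| ≤ |ϖ|^{1+s}`. [cite: Kottwitz1986BaseChangeUnits, §1 pp. 240–241] -/
theorem mapGL_latt_rhoZero_eq_of_depths {ϖ : K} (hϖ : Valued.v ϖ = WithZero.exp (-1 : ℤ)) {α β : K} (hα : Valued.v α = 1) (hβ : Valued.v β = 1)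
    (T : GL (Fin 3) K) (hT : (T : Matrix (Fin 3) (Fin 3) K) = Matrix.diagonal ![α, β, 1]) {n₁ n₂ : ℕ}
    (h₁ : Valued.v (β - 1) = Valued.v ϖ ^ n₁) (h₂ : Valued.v (α - 1) = Valued.v ϖ ^ n₂) {s : ℕ} (hn₁ : 1 + s ≤ n₁) (hn₂ : 1 ≤ n₂)
    {y ζ : K} (hζ : Valued.v ζ = 1) (hy : Valued.v y = Valued.v ϖ ^ s) (V : GL (Fin 3) K) (hV : (V : Matrix (Fin 3) (Fin 3) K) = !![1, 0, 0; 0, 1, 0; y, ζ, ϖ ^ (1 + s)]) :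
    mapGL T (latt (V : Matrix (Fin 3) (Fin 3) K)) = latt (V : Matrix (Fin 3) (Fin 3) K) := by
  obtain ⟨hϖ0, hϖ1⟩ := ne_zero_and_v_lt_one_of_v_eq_exp hϖ
  have hanti : ∀ {a b : ℕ}, a ≤ b → Valued.v ϖ ^ b ≤ Valued.v ϖ ^ a := fun h => pow_le_pow_right_of_le_one' hϖ1.le h
  have hαβ : ∀ i, Valued.v ((![α, β, 1] : Fin 3 → K) i) = 1 := by
    intro i; fin_cases i
    · exact hα
    · exact hβ
    · exact map_one _
  have hV' : (V : Matrix (Fin 3) (Fin 3) K) = !![1, 0, 0; 0, ϖ ^ 0, 0; y, ζ, ϖ ^ (1 + s)] := by rw [hV, pow_zero]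
  rw [mapGL_latt_hnf_eq_iff hϖ0 ![α, β, 1] hαβ T hT V hV']
  simp only [Matrix.cons_val_zero, Matrix.cons_val_one, Matrix.cons_val_two, Matrix.head_cons, Matrix.tail_cons]
  refine ⟨by rw [mul_zero, zero_mul, map_zero]; exact zero_le, ?_, ?_⟩
  · rw [v_mul_inv_le_one_iff (pow_ne_zero _ hϖ0), map_mul, Valuation.map_sub_swap, h₁, hζ, mul_one, map_pow]
    exact hanti hn₁
  · rw [v_mul_inv_le_one_iff (pow_ne_zero _ hϖ0), show (1 - α) * y + (α - β) * 0 * ζ * (ϖ ^ 0)⁻¹ = (1 - α) * y by ring, map_mul,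
      Valuation.map_sub_swap, h₂, hy, ← pow_add, map_pow]
    exact hanti (by omega)

/-- **OFF THE TUBE NOTHING IS STABLE**: if `n₁ < 1 + s` no root-glued lattice is `T`-stable. [cite: Kottwitz1986BaseChangeUnits, §1 pp. 240–241] -/
theorem not_mapGL_latt_rhoZero_eq_of_lt {ϖ : K} (hϖ : Valued.v ϖ = WithZero.exp (-1 : ℤ)) {α β : K} (hα : Valued.v α = 1) (hβ : Valued.v β = 1)
    (T : GL (Fin 3) K) (hT : (T : Matrix (Fin 3) (Fin 3) K) = Matrix.diagonal ![α, β, 1]) {n₁ : ℕ}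
    (h₁ : Valued.v (β - 1) = Valued.v ϖ ^ n₁) {s : ℕ} (hn₁ : n₁ < 1 + s)
    {y ζ : K} (hζ : Valued.v ζ = 1) (V : GL (Fin 3) K) (hV : (V : Matrix (Fin 3) (Fin 3) K) = !![1, 0, 0; 0, 1, 0; y, ζ, ϖ ^ (1 + s)]) :
    mapGL T (latt (V : Matrix (Fin 3) (Fin 3) K)) ≠ latt (V : Matrix (Fin 3) (Fin 3) K) := by
  obtain ⟨hϖ0, hϖ1⟩ := ne_zero_and_v_lt_one_of_v_eq_exp hϖ
  have hvϖ : 0 < Valued.v ϖ := (Valuation.pos_iff _).2 hϖ0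
  have hαβ : ∀ i, Valued.v ((![α, β, 1] : Fin 3 → K) i) = 1 := by
    intro i; fin_cases i
    · exact hα
    · exact hβ
    · exact map_one _
  have hV' : (V : Matrix (Fin 3) (Fin 3) K) = !![1, 0, 0; 0, ϖ ^ 0, 0; y, ζ, ϖ ^ (1 + s)] := by rw [hV, pow_zero]
  intro hstab
  obtain ⟨-, h2, -⟩ := (mapGL_latt_hnf_eq_iff hϖ0 ![α, β, 1] hαβ T hT V hV').1 hstab
  simp only [Matrix.cons_val_zero, Matrix.cons_val_one, Matrix.cons_val_two, Matrix.head_cons, Matrix.tail_cons] at h2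
  rw [v_mul_inv_le_one_iff (pow_ne_zero _ hϖ0), map_mul, Valuation.map_sub_swap, h₁, hζ, mul_one, map_pow, pow_le_pow_iff_right_of_lt_one₀ hvϖ hϖ1] at h2
  omega

/-- **TYPE 2, ρ = 0 — THE TUBE SUM `Σ w = q^{s∕2}`**: for `T = diag(α, β, 1)` with `1 + s ≤ n₁`, `1 ≤ n₂`, `s` even, over the ramified quadratic datum, the `T`-stable root-glued lattices
`latt (1 0 0; 0 1 0; y ζ ϖ^{1+s})` (`|ζ| = 1`, `|y| = |ϖ|^s`; all stable, §4) have total weight `q^{s∕2}` — `((q−1)q^s)(q−1)` lattices (§3) of weight `1∕(((q−1)q^{s∕2})(q−1))` (§2).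
The B10₂ skeleton 08e5e6e2 `G₁` tube value at ρ = 0, `(q−1)q^{s∕2}`, is `(q−1) = n₂` times this. [cite: Kottwitz1986BaseChangeUnits, §1 pp. 240–241] [cite: Serre1979, Ch. IV §2 Prop. 6] -/
theorem finsum_stabiliserWeight_rhoZero_tube_typeTwo_eq {σ : K →+* K} (hσ : ∀ a, σ (σ a) = a) (hvσ : ∀ a, Valued.v (σ a) = Valued.v a)
    (hfix : ∀ x : K, σ x = x → x ≠ 0 → ∃ n : ℤ, Valued.v x = WithZero.exp (2 * n)) {ϖ : K} (hϖ : Valued.v ϖ = WithZero.exp (-1 : ℤ))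
    {d : ℕ} (hd : Valued.v (ϖ - σ ϖ) = Valued.v ϖ ^ d) [Finite 𝓀[K]]
    {α β : K} (hα : Valued.v α = 1) (hβ : Valued.v β = 1) (T : GL (Fin 3) K) (hT : (T : Matrix (Fin 3) (Fin 3) K) = Matrix.diagonal ![α, β, 1])
    {n₁ n₂ : ℕ} (h₁ : Valued.v (β - 1) = Valued.v ϖ ^ n₁) (h₂ : Valued.v (α - 1) = Valued.v ϖ ^ n₂)
    (s : ℕ) (hs : 2 ∣ s) (hn₁ : 1 + s ≤ n₁) (hn₂ : 1 ≤ n₂) :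
    ∑ᶠ M ∈ {M : Submodule 𝒪[K] (Fin 3 → K) | ∃ y ζ : K, Valued.v ζ = 1 ∧ Valued.v y = Valued.v ϖ ^ s ∧
        M = latt (!![1, 0, 0; 0, 1, 0; y, ζ, ϖ ^ (1 + s)] : Matrix (Fin 3) (Fin 3) K) ∧ mapGL T M = M},
        stabiliserWeight σ M = (Nat.card 𝓀[K] : ℚ) ^ (s / 2) := by
  obtain ⟨hϖ0, -⟩ := ne_zero_and_v_lt_one_of_v_eq_exp hϖ
  have hq : 1 < Nat.card 𝓀[K] := Finite.one_lt_card
  -- the stability conjunct is automatic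
  have hset : {M : Submodule 𝒪[K] (Fin 3 → K) | ∃ y ζ : K, Valued.v ζ = 1 ∧ Valued.v y = Valued.v ϖ ^ s ∧
        M = latt (!![1, 0, 0; 0, 1, 0; y, ζ, ϖ ^ (1 + s)] : Matrix (Fin 3) (Fin 3) K) ∧ mapGL T M = M} =
      {M | ∃ y ζ : K, Valued.v ζ = 1 ∧ Valued.v y = Valued.v ϖ ^ s ∧ M = latt (!![1, 0, 0; 0, 1, 0; y, ζ, ϖ ^ (1 + s)] : Matrix (Fin 3) (Fin 3) K)} := by
    ext M
    constructor
    · rintro ⟨y, ζ, hζ, hy, hM, -⟩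
      exact ⟨y, ζ, hζ, hy, hM⟩
    · rintro ⟨y, ζ, hζ, hy, hM⟩
      obtain ⟨V, hV'⟩ := exists_gl_coe_eq_glued (0 : K) ζ y (one_ne_zero) (pow_ne_zero (1 + s) hϖ0)
      have hV : (V : Matrix (Fin 3) (Fin 3) K) = !![1, 0, 0; 0, 1, 0; y, ζ, ϖ ^ (1 + s)] := by rw [hV', zero_mul, zero_add, one_mul]
      refine ⟨y, ζ, hζ, hy, hM, ?_⟩
      rw [hM, ← hV]
      exact mapGL_latt_rhoZero_eq_of_depths hϖ hα hβ T hT h₁ h₂ hn₁ hn₂ hζ hy V hV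
  -- the weight is constant
  have hw : ∀ M ∈ {M : Submodule 𝒪[K] (Fin 3 → K) | ∃ y ζ : K, Valued.v ζ = 1 ∧ Valued.v y = Valued.v ϖ ^ s ∧
        M = latt (!![1, 0, 0; 0, 1, 0; y, ζ, ϖ ^ (1 + s)] : Matrix (Fin 3) (Fin 3) K)},
      stabiliserWeight σ M = ((((Nat.card 𝓀[K] - 1) * Nat.card 𝓀[K] ^ ((1 + s + 1) / 2 - 1)) * ((Nat.card 𝓀[K] - 1) * Nat.card 𝓀[K] ^ ((1 + s - s + 1) / 2 - 1)) : ℕ) : ℚ)⁻¹ := by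
    rintro M ⟨y, ζ, hζ, hy, rfl⟩
    obtain ⟨V, hV'⟩ := exists_gl_coe_eq_glued (0 : K) ζ y (one_ne_zero) (pow_ne_zero (1 + s) hϖ0)
    have hV : (V : Matrix (Fin 3) (Fin 3) K) = !![1, 0, 0; 0, 1, 0; y, ζ, ϖ ^ (1 + s)] := by rw [hV', zero_mul, zero_add, one_mul]
    rw [← hV]
    unfold stabiliserWeight
    rw [relIndex_fixedUnitStabilizer_latt_rhoZero_eq hσ hvσ hfix hϖ hd (s := s) (c := 1 + s) (by omega) hζ hy V hV]
  have hcount := ncard_rhoZero_eq hϖ (K := K) (s := s) (c := 1 + s) (by omega)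
  have hne : ((Nat.card 𝓀[K] - 1) * Nat.card 𝓀[K] ^ (1 + s - 1)) * ((Nat.card 𝓀[K] - 1) * Nat.card 𝓀[K] ^ (1 + s - s - 1)) ≠ 0 :=
    mul_ne_zero (mul_ne_zero (by omega) (pow_ne_zero _ (by omega))) (mul_ne_zero (by omega) (pow_ne_zero _ (by omega)))
  have hfin := Set.finite_of_ncard_ne_zero (hcount ▸ hne)
  rw [hset, finsum_mem_eq_ncard_mul hfin _ _ hw, hcount]
  obtain ⟨t, rfl⟩ := hs
  rw [show 1 + 2 * t - 1 = 2 * t by omega, show 1 + 2 * t - 2 * t - 1 = 0 by omega, show (1 + 2 * t + 1) / 2 - 1 = t by omega,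
    show (1 + 2 * t - 2 * t + 1) / 2 - 1 = 0 by omega, show 2 * t / 2 = t by omega]
  have hq1 : ((Nat.card 𝓀[K] : ℚ) - 1) ≠ 0 := sub_ne_zero.2 (by exact_mod_cast hq.ne')
  have hq0 : (Nat.card 𝓀[K] : ℚ) ≠ 0 := by exact_mod_cast (by omega : Nat.card 𝓀[K] ≠ 0)
  push_cast [Nat.cast_sub hq.le]
  field_simp
  ring

end Summit.HodgeConjecture.HodgeConjecture.Cruxes.H413.F0P3cDyRamDiagonalGluedRhoZero

end
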